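import Summits.QuantumFields.BalabanUV.Beta.D1BFx.PackedColumnBlockTotalMass

/-!
# `BalabanUV.Beta.D1BFx.PackedColumnBlockTotalOfPerSlot` — road «BF-x» for binder row D1, slot (K), the [M] mass currencies: **CURRENCY (A) IMPLIES
# CURRENCY (B) — PER-SLOT LETTERS GIVE BLOCK-TOTAL LETTERS WITH THE SAME TABLE, AND PER-SLOT-PAIR LETTERS WITH TWO-SLOT DECAY AT THE BLOCK-SCALE RATE
# GIVE BLOCK-PAIR-TOTAL LETTERS WITH COARSE DECAY IN BLOCK UNITS** (`#box D n = n^D`; offsets `|b|₁ ≤ D·n`; UNCONDITIONAL, generic + `d = 3` instances in the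
# exact binder shapes of `PackedColumnBlockTotalMass.mass_blk_vertexOfK_G₀_le_of_blockTotal` (`hSB`) and `PackedColumnBlockPairTotalMass.mass_blk_vertex2OfK_G₀_le_of_blockPairTotal` (`hTB`))

HONEST DEPENDENCY (cell records, verbatim): «continuum YM on T⁴ ⇐ BetaPertH ∧ nine spine estimates (0/9 proved); BetaPertH ⇐ (D1) ∧ (D4) ∧
CAP+tail; G-an2-4 gates asym, D1 and NE2/3/4.»  HONEST FRAMING (cell contract, verbatim): «discharging `BetaPertH` makes Bałaban's UV stability
UNCONDITIONAL — a real constructive-QFT result; it is NOT the continuum limit and NOT the Clay problem.»  THIS MODULE DISCHARGES NOTHING of the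
wall: [folklore] finite counting (`Finset.sum_const`, the box's cardinality) and the in-block offset estimate of this lineage's `PackedColumnBlockTotalMass`.
No definition, no `def … : Prop`, nothing cited, 0 sorry.  NO (1.22) unit row is proved here; nothing of Bałaban's (or an1's ∕ an3's) tables asserted.
0 root-level binders of row D1 discharged; (J1)∕[W] OPEN; (K) NOT closed; NOT D1, NOT `BetaPertH`, NOT continuum, NOT Clay.

ABSOLUTE RULE (cell charter, verbatim): «No internally-minted statement may enter as a cited fact. Every hypothesis is either kernel-proved in
this package or a verbatim quotation of a PUBLISHED theorem with page reference. The manuscript(s) under audit are NOT citable for their own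
disputed steps — they are the thing under adjudication; programme-internal (2001/route/tribunal) claims are never citable.»

WHY (OWNER d1-p2 g22 ρ-g22-1 (b), journal: the mass head re-cut «17-M♭» splits the END's [M] input per block — ff per slot (`hSs hSm`), mm = 0, fm∕mf PACKED
from block totals; `S₂`'s `hBs hBm` likewise split for `vh₂S`).  With this file the split can be UNIFORM: a k-free PER-SLOT letter (the Wilson ∕ ff sector —
d1-leaf-01's `RawStencilSupportRows.mass_blk_wilsonA_le`, `RawPairStencilSupportRows.hBm_wilsonW₂`) IS a block-total (resp. block-pair-total) letter with the
same table, so a mass head may display block-total letters for EVERY block and feed them sector by sector — the ff sector from its per-slot bound here, the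
border sectors from the table author's count.  `n = m + 1`.

CONTENT (all [folklore]).
* §1 slots: **`blockTotal_le_of_forall_le`** (generic: `m u ≤ M` ⟹ `Σ_{b ∈ box D n} m (n•y′ + b) ≤ n^D·M`), **`hSB_of_hSm`** (`d = 3`: the END's `hSm` ⟹ `hSB` with
  `m̄S := mS`).
* §2 pairs: **`blockPairTotal_le_of_forall_le`** (generic: `m u u′ ≤ M·e^{−δ|u′ − u|₁}`, `0 ≤ δ`, `0 ≤ M` ⟹
  `Σ_{b,b′} m (n•y₁ + b) (n•y₂ + b′) ≤ n^D·n^D·M·e^{2δDn}·e^{−(δn)|y₂ − y₁|₁}`), **`hTB_of_hBm`** (`d = 3`: the END's `hBm` at the block-scale rate `δ₀∕n`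
  ⟹ `hTB` with `m̄B := e^{8δ₀}·mB`, `θ := δ₀`).
Unit `b2b-balaban-gan24-formalise-leaf-05` (gen 57), G-an2-4 swarm leaf prover 05, road «BF-x» supplier; INTENT-3 (journal).
-/

noncomputable section

open Finset
open scoped BigOperators
open Literature.MathematicalPhysics.QuantumFieldTheory.Balaban1983to89
open Literature.MathematicalPhysics.QuantumFieldTheory.Balaban1983to89.Beta
open B12Sec2to5 (l1 l1_nonneg)
open ExpKernelCalculus (Site MKer Zl l1_natSmul l1_sub_triangle l1_sub_symm)
open AffineAveraging (box toSite)
open OneStepResolventKernel (Fib)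
open Summit.QuantumFields.BalabanUV.Beta.D1BFx.PackedKernelSplit (blk)
open Summit.QuantumFields.BalabanUV.Beta.D1BFx.PackedColumnBlockTotalMass (l1_toSite_le_of_mem_box)

namespace Summit.QuantumFields.BalabanUV.Beta.D1BFx.PackedColumnBlockTotalOfPerSlot

/-! ## §1 Slots: a per-slot bound gives a block-total bound -/

section Slot

/-- [folklore] **A PER-SLOT BOUND GIVES A BLOCK-TOTAL BOUND** (generic; any dimension `D`, block side `n`): if `m u ≤ M` for every slot then every block
total is at most `n^D·M` (`#box D n = n^D`).  So the END's per-slot letters (currency (A)) are a SPECIAL CASE of the block-total letters (currency (B)) with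
the same table — a mass head may display block-total letters for ALL blocks, feeding the ff block from its k-free per-slot bound (d1-leaf-01's
`RawStencilSupportRows.mass_blk_wilsonA_le`) and the fm ∕ mf blocks from the table author's count. -/
theorem blockTotal_le_of_forall_le {D n : ℕ} {m : (Fin D → ℤ) → ℝ} {M : ℝ} (h : ∀ u, m u ≤ M) (y' : Fin D → ℤ) :
    ∑ b ∈ box D n, m ((n : ℤ) • y' + toSite b) ≤ ((n : ℝ) ^ D) * M := by
  have hcard : (box D n).card = n ^ D := by
    simp [AffineAveraging.box, Fintype.card_piFinset, Finset.card_range, Finset.prod_const, Finset.card_univ, Fintype.card_fin]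
  calc ∑ b ∈ box D n, m ((n : ℤ) • y' + toSite b) ≤ ∑ _b ∈ box D n, M := Finset.sum_le_sum fun b _ => h _
    _ = ((box D n).card : ℝ) * M := by rw [Finset.sum_const, nsmul_eq_mul]
    _ = ((n : ℝ) ^ D) * M := by rw [hcard]; push_cast; ring

/-- [folklore] **`hSm ⟹ hSB` (`d = 3`)**: the END's per-slot mass letters `Σ'|blk (S κ u) j k|·e^{σ(…)} ≤ mS j k` (`PackedRoadRowsMass.jet_letters_mass`'s `hSm`, one
blocking) give the block-total letters `hSB` of `PackedColumnBlockTotalMass.mass_blk_vertexOfK_G₀_le_of_blockTotal` (and of its `GcombSh` twin) with `m̄S := mS`,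
character for character. -/
theorem hSB_of_hSm (m : ℕ) {S : Fin (3 + 1) → (Fin (3 + 1) → ℤ) → MKer 4 (Fib 3)} {σ : ℝ} {mS : Bool → Bool → ℝ}
    (hSm : ∀ κ u j k, ∑' p : Site 4 × Site 4,
      ∑ g, ∑ f, |blk (S κ u) j k p.1 p.2 g f| * Real.exp (σ * (l1 (p.1 - u) + l1 (p.2 - u))) ≤ mS j k) :
    ∀ (κ : Fin (3 + 1)) (y' : Fin (3 + 1) → ℤ) (j k : Bool), ∑ b ∈ box (3 + 1) (m + 1),
      (∑' p : Site 4 × Site 4, ∑ g, ∑ f, |blk (S κ (((m + 1 : ℕ) : ℤ) • y' + toSite b)) j k p.1 p.2 g f|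
        * Real.exp (σ * (l1 (p.1 - (((m + 1 : ℕ) : ℤ) • y' + toSite b)) + l1 (p.2 - (((m + 1 : ℕ) : ℤ) • y' + toSite b)))))
      ≤ ((m + 1 : ℕ) : ℝ) ^ 4 * mS j k := by
  intro κ y' j k
  have h := blockTotal_le_of_forall_le (D := 3 + 1) (n := m + 1)
    (m := fun u => ∑' p : Site 4 × Site 4, ∑ g, ∑ f, |blk (S κ u) j k p.1 p.2 g f| * Real.exp (σ * (l1 (p.1 - u) + l1 (p.2 - u))))
    (fun u => hSm κ u j k) y'
  simpa using h

end Slot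
/-! ## §2 Pairs: a per-slot-pair bound with two-slot decay gives a block-pair-total bound with coarse decay -/

section Pair

/-- [folklore] **A PER-SLOT-PAIR BOUND WITH TWO-SLOT DECAY GIVES A BLOCK-PAIR-TOTAL BOUND WITH COARSE DECAY** (generic): if
`m u u′ ≤ M·e^{−δ|u′ − u|₁}` (`0 ≤ δ`, `0 ≤ M`) then every block-pair total is at most `n^D·n^D·M·e^{2δDn}·e^{−(δn)|y₂ − y₁|₁}`
(`|u′ − u|₁ ≥ n|y₂ − y₁|₁ − |b′|₁ − |b|₁`, `|b|₁, |b′|₁ ≤ D·n`). -/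
theorem blockPairTotal_le_of_forall_le {D n : ℕ} {m : (Fin D → ℤ) → (Fin D → ℤ) → ℝ} {M δ : ℝ} (hδ : 0 ≤ δ) (hM : 0 ≤ M)
    (h : ∀ u u', m u u' ≤ M * Real.exp (-δ * l1 (u' - u))) (y₁ y₂ : Fin D → ℤ) :
    ∑ b ∈ box D n, ∑ b' ∈ box D n, m ((n : ℤ) • y₁ + toSite b) ((n : ℤ) • y₂ + toSite b')
      ≤ ((n : ℝ) ^ D * (n : ℝ) ^ D * M * Real.exp (2 * δ * (D : ℝ) * (n : ℝ))) * Real.exp (-(δ * (n : ℝ)) * l1 (y₂ - y₁)) := by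
  have hcard : (box D n).card = n ^ D := by
    simp [AffineAveraging.box, Fintype.card_piFinset, Finset.card_range, Finset.prod_const, Finset.card_univ, Fintype.card_fin]
  -- termwise: the two-slot decay read in block units, paying both offsets
  have hpt : ∀ b ∈ box D n, ∀ b' ∈ box D n, m ((n : ℤ) • y₁ + toSite b) ((n : ℤ) • y₂ + toSite b')
      ≤ M * Real.exp (2 * δ * (D : ℝ) * (n : ℝ)) * Real.exp (-(δ * (n : ℝ)) * l1 (y₂ - y₁)) := by
    intro b hb b' hb'
    refine (h _ _).trans ?_
    rw [mul_assoc, ← Real.exp_add]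
    refine mul_le_mul_of_nonneg_left (Real.exp_le_exp.2 ?_) hM
    -- `n|y₂ − y₁|₁ ≤ |b|₁ + |u′ − u|₁ + |b′|₁`
    have e1 : l1 ((n : ℤ) • y₂ - (n : ℤ) • y₁) = (n : ℝ) * l1 (y₂ - y₁) := by rw [← smul_sub, l1_natSmul]
    have t1 := l1_sub_triangle ((n : ℤ) • y₂) ((n : ℤ) • y₂ + toSite b') ((n : ℤ) • y₁)
    have t2 := l1_sub_triangle ((n : ℤ) • y₂ + toSite b') ((n : ℤ) • y₁ + toSite b) ((n : ℤ) • y₁)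
    have e2 : l1 ((n : ℤ) • y₂ - ((n : ℤ) • y₂ + toSite b')) = l1 (toSite b') := by
      rw [l1_sub_symm, add_sub_cancel_left]
    have e3 : l1 ((n : ℤ) • y₁ + toSite b - (n : ℤ) • y₁) = l1 (toSite b) := by rw [add_sub_cancel_left]
    rw [e1] at t1
    rw [e2] at t1
    rw [e3] at t2
    have hb1 := l1_toSite_le_of_mem_box hb
    have hb2 := l1_toSite_le_of_mem_box hb'
    nlinarith [hδ, l1_nonneg (y₂ - y₁), l1_nonneg ((n : ℤ) • y₂ + toSite b' - ((n : ℤ) • y₁ + toSite b))]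
  calc ∑ b ∈ box D n, ∑ b' ∈ box D n, m ((n : ℤ) • y₁ + toSite b) ((n : ℤ) • y₂ + toSite b')
      ≤ ∑ b ∈ box D n, ∑ b' ∈ box D n, M * Real.exp (2 * δ * (D : ℝ) * (n : ℝ)) * Real.exp (-(δ * (n : ℝ)) * l1 (y₂ - y₁)) :=
        Finset.sum_le_sum fun b hb => Finset.sum_le_sum fun b' hb' => hpt b hb b' hb'
    _ = ((box D n).card : ℝ) * (((box D n).card : ℝ) * (M * Real.exp (2 * δ * (D : ℝ) * (n : ℝ)) * Real.exp (-(δ * (n : ℝ)) * l1 (y₂ - y₁)))) := by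
        rw [Finset.sum_const, nsmul_eq_mul, Finset.sum_const, nsmul_eq_mul]
    _ = ((n : ℝ) ^ D * (n : ℝ) ^ D * M * Real.exp (2 * δ * (D : ℝ) * (n : ℝ))) * Real.exp (-(δ * (n : ℝ)) * l1 (y₂ - y₁)) := by
        rw [hcard]; push_cast; ring

/-- [folklore] **`hBm ⟹ hTB` (`d = 3`)**: the END's per-slot-pair letters at the block-scale rate, `Σ'|blk (S₂ κ u κ′ u′) j i| ≤ mB j i·e^{−(δ₀∕n)|u′ − u|₁}`
(`PackedRoadRowsMass.table_letters_mass`'s `hBm`, one blocking, `0 ≤ δ₀`, `0 ≤ mB j i`), give the block-pair-total letters of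
`PackedColumnBlockPairTotalMass.mass_blk_vertex2OfK_G₀_le_of_blockPairTotal` with `m̄B := e^{8δ₀}·mB`, `θ := δ₀`. -/
theorem hTB_of_hBm (m : ℕ) {S₂ : Fin 4 → Site 4 → Fin 4 → Site 4 → MKer 4 (Fib 3)} {δ₀ : ℝ} {mB : Bool → Bool → ℝ} (hδ₀ : 0 ≤ δ₀)
    (hmB : ∀ j i, 0 ≤ mB j i)
    (hBm : ∀ κ u κ' u' j i, ∑' p : Site 4 × Site 4, ∑ g, ∑ f, |blk (S₂ κ u κ' u') j i p.1 p.2 g f|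
      ≤ mB j i * Real.exp (-(δ₀ / ((m + 1 : ℕ) : ℝ)) * l1 (u' - u))) :
    ∀ (κ κ' : Fin 4) (y₁ y₂ : Site 4) (j i : Bool), ∑ b ∈ box 4 (m + 1), ∑ b' ∈ box 4 (m + 1),
      (∑' p : Site 4 × Site 4, ∑ g, ∑ f,
        |blk (S₂ κ (((m + 1 : ℕ) : ℤ) • y₁ + toSite b) κ' (((m + 1 : ℕ) : ℤ) • y₂ + toSite b')) j i p.1 p.2 g f|)
        ≤ ((m + 1 : ℕ) : ℝ) ^ 8 * (Real.exp (8 * δ₀) * mB j i) * Real.exp (-δ₀ * l1 (y₂ - y₁)) := by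
  intro κ κ' y₁ y₂ j i
  have hn0 : (0 : ℝ) < ((m + 1 : ℕ) : ℝ) := by exact_mod_cast Nat.succ_pos m
  have hδ : 0 ≤ δ₀ / ((m + 1 : ℕ) : ℝ) := div_nonneg hδ₀ hn0.le
  have h := blockPairTotal_le_of_forall_le (D := 4) (n := m + 1)
    (m := fun u u' => ∑' p : Site 4 × Site 4, ∑ g, ∑ f, |blk (S₂ κ u κ' u') j i p.1 p.2 g f|) hδ (hmB j i)
    (fun u u' => hBm κ u κ' u' j i) y₁ y₂
  refine h.trans (le_of_eq ?_)
  have e1 : 2 * (δ₀ / ((m + 1 : ℕ) : ℝ)) * ((4 : ℕ) : ℝ) * ((m + 1 : ℕ) : ℝ) = 8 * δ₀ := by field_simp; ring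
  have e2 : δ₀ / ((m + 1 : ℕ) : ℝ) * ((m + 1 : ℕ) : ℝ) = δ₀ := by field_simp
  rw [e1, e2]
  ring

end Pair

end Summit.QuantumFields.BalabanUV.Beta.D1BFx.PackedColumnBlockTotalOfPerSlot

end
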